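/-
Copyright (c) 2026 the pub-hodgecm-mathlib formalisation cell (harness21).  Prover seat hodgecm-mathlib-K2E3-p21 (g5), Track B «K2-LIT» ∕ h413
(`stmt-HodgeConjecture-24833`), line `K2_E3_EllipticInputs`, unit U12 §L, road «GL-[M6]-sc» (line lead K2E3-p23 (g5); T20-GL₃ co-owned with K2E5-p17 (g4), deal
«(C-shell) DESCENT» 2026-09-04T07:33:37Z (dealer) ∕ 07:41:37Z (K2E5-p17: «it is yours; build against this»)), brick T20-GL₃ (C-shell A): «THE DESCENT OF THE LEVEL-`GL₃(𝒪)`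
CANCELLATION FROM `GL₃(F)` TO THE SHELLS OF `G' = GL₃(F) ⧸ ϖ^ℤ·1`».  2026-09-04.
-/
import Summits.HodgeConjecture.HodgeConjecture.Theorems.K2E3GL3SupercuspidalCharLocInt            -- ★ B6-final p857950 (K2E3-p23 g5): `eq_one_of_mem_glInt_of_mk_eq_one`; brings ★ B0b `K2E3CoveringHomLocalHaar`, ★ B0z, ★ B2, ★ B0a-U, ★ GL-P
import Summits.HodgeConjecture.HodgeConjecture.Theorems.K2E3RightInvariantSetIntegralVanishing    -- ★ f1 (K2E3-p14 g3): `setIntegral_eq_zero_of_forall_setIntegral_mul_eq_zero`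
import HarnessLib

/-!
# K2_E3 road (h413), T20-GL₃ (C-shell A): descent of Harish-Chandra's Theorem 20 from the level `GL₃(𝒪)` upstairs in `GL₃(F)` to the shells `Ω n ∖ Ω R` of
# `G' = GL₃(F) ⧸ ϖ^ℤ·1` — the `hcanc` conjunct of ★ ASM-core `nonEllEstimates_of_radius`

Cell `pub/hodgecm-mathlib` (D-0151), Track B, seat K2E3-p21 (g5).  CONSUMED INPUT = K2E5-p17 (g4)'s (C) head `cuspForm_cancellation_GL3_split` (REPORT-FIRST 07:41:37Z):
`… (hx : ¬ 𝔅_R(x)) : ∫ k in ↑(glInt 3 F), f (x * k * y) ∂μ = 0` UPSTAIRS (`μ` any Haar measure of `GL₃(F)`, `𝔅_R(x) :≡ ∀ i j k l, v(ϖ^R · x_ij · (x⁻¹)_kl) ≤ 1`, p14's ★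
`exists_adHeightBall_compactExhaustion_quotScalar` `hmem` RHS verbatim).  OUTPUT = the SHELL statements DOWNSTAIRS on `G'` for any Haar `μ'` and any compact exhaustion `Ω` with
p14's `hmem`∕`hK` (taken as hypotheses on an abstract `Ω : CompactExhaustion G'`), for an arbitrary continuous `F' : G' → E` resp. the conjugation slice
`F' x̄ = θ(x̄ ḡ x̄⁻¹)`, `ḡ = mk (y γ y⁻¹)`, `f z = θ(mk(z γ z⁻¹))` (then `f (x k y) = F' (mk (x k))`).  `--supports stmt-HodgeConjecture-24833 --as helper`; THEOREMS ONLY.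

THE MATHEMATICS [HarishChandra1970, Part VII §3 p. 71 eq. (1), p. 72 (`Ω(γ)`); §2 Thm 20 p. 70]; [WeilBNT1967, Ch. II §5]; [Folland1995, §2.6]:
* §1 **`setIntegral_kLambda_eq_zero_of_setIntegral_glInt_eq_zero`** — `GL₃(𝒪) ∩ ϖ^ℤ·1 = 1` (★ `eq_one_of_mem_glInt_of_mk_eq_one`), so `mk` maps `K₁ = GL₃(𝒪)` isomorphically onto the
  compact open `K_Λ = mk(K₁)` and `mk_*(μ|_{K₁}) = c · μ'|_{K_Λ}` with `c > 0` (★ B0b `exists_map_restrict_smul_eq` at `g = 1`): `∫_{K₁} F'(mk(x k)) dμ(k) = 0 ⇒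
  ∫_{K_Λ} F'(mk x · k') dμ'(k') = 0`.
* §2 **`setIntegral_sdiff_eq_zero_of_forall_upstairs`**, **`setIntegral_eq_setIntegral_inter_of_forall_upstairs`** — the shell `Ω n ∖ Ω R` is relatively compact, measurable
  and right-`K_Λ`-invariant (`hK`), every point of it is `mk x` with `¬ 𝔅_R(x)` (`hmem`), so ★ f1 `setIntegral_eq_zero_of_forall_setIntegral_mul_eq_zero` (right-invariant Haar
  `μ'`, ★ B0a-U `isMulRightInvariant_quotScalar_of_isHaarMeasure`) turns the level statements of §1 into `∫_{Ω n ∖ Ω R} F' dμ' = 0`, i.e. `∫_{Ω n} F' = ∫_{Ω n ∩ Ω R} F'`.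
* §3 **`setIntegral_conj_eq_setIntegral_inter_of_cuspForm_cancellation`** — the reading for (C): from `∀ x, ¬𝔅_R(x) → ∫_{K₁} θ(mk((x k y) γ (x k y)⁻¹)) dμ(k) = 0` to the
  `hcanc` conjunct `∀ n, ∫_{Ω n} θ(x̄ ḡ x̄⁻¹) dμ' = ∫_{Ω n ∩ Ω R} θ(x̄ ḡ x̄⁻¹) dμ'` of ★ ASM-core `nonEllEstimates_of_radius` at `ḡ = mk (y γ y⁻¹)` (pointwise in `(γ, y)`; ASM
  quantifies a.e.).

HONEST LABEL: HC_CM is proved only modulo the 7 printed citations (2 remaining named inputs: hLiu418 = `stmt-HodgeConjecture-24832`, h413 = `stmt-HodgeConjecture-24833`)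
until rung 0 closes; this file is a count-neutral helper and closes no socket.

## References
* [HarishChandra1970] Harish-Chandra (notes by G. van Dijk), *Harmonic Analysis on Reductive p-adic Groups*, LNM 162 (1970), Part VII §2 Thm 20 p. 70, §3 pp. 71–72.
* [WeilBNT1967] A. Weil, *Basic Number Theory* (1967), Ch. II §5 (Haar measures and local isomorphisms).
* [Folland1995] G. B. Folland, *A Course in Abstract Harmonic Analysis* (1995), §2.4, §2.6.
-/

set_option autoImplicit false
-- the mandated namespace repeats the single-problem summit's segment (`HodgeConjecture.HodgeConjecture`)
set_option linter.dupNamespace false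

noncomputable section

open MeasureTheory MeasureTheory.Measure Set Filter Topology
open scoped MatrixGroups Pointwise NNReal WithZero
open Literature.NumberTheory.Automorphic Literature.NumberTheory.GaloisRepresentations Literature.NumberTheory.GaloisRepresentations.IsNonarchimedeanLocalField
open Summit.HodgeConjecture.HodgeConjecture.Cruxes.H413.K2E3GL3ModCentre
open Summit.HodgeConjecture.HodgeConjecture.Cruxes.H413.K2E3GL3ModCocompactCentral
open Summit.HodgeConjecture.HodgeConjecture.Cruxes.H413.K2E3GL3ModCocompactUnimodular
open Summit.HodgeConjecture.HodgeConjecture.Cruxes.H413.K2E3GL3ModUniformizerCocompact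
open Summit.HodgeConjecture.HodgeConjecture.Cruxes.H413.K2E3GL3SupercuspidalCharLocInt (eq_one_of_mem_glInt_of_mk_eq_one)

namespace Summit.HodgeConjecture.HodgeConjecture.Cruxes.H413.K2E3GL3CuspFormCancellationShell

variable {F : Type*} [Field F] [Valued F ℤᵐ⁰] [ValuativeRel F] [(Valued.v : Valuation F ℤᵐ⁰).Compatible] [IsNonarchimedeanLocalField F]
  {ϖ : F} (hϖ : Valued.v ϖ = WithZero.exp (-1 : ℤ)) (hϖ0 : ϖ ≠ 0)
  [((Subgroup.zpowers (Units.mk0 ϖ hϖ0)).map (Matrix.GeneralLinearGroup.scalar (Fin 3))).Normal]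
  [MeasurableSpace (GL (Fin 3) F)] [BorelSpace (GL (Fin 3) F)]
  [MeasurableSpace (GL (Fin 3) F ⧸ (Subgroup.zpowers (Units.mk0 ϖ hϖ0)).map (Matrix.GeneralLinearGroup.scalar (Fin 3)))]
  [BorelSpace (GL (Fin 3) F ⧸ (Subgroup.zpowers (Units.mk0 ϖ hϖ0)).map (Matrix.GeneralLinearGroup.scalar (Fin 3)))]
  (μ : Measure (GL (Fin 3) F)) [μ.IsHaarMeasure]
  (μ' : Measure (GL (Fin 3) F ⧸ (Subgroup.zpowers (Units.mk0 ϖ hϖ0)).map (Matrix.GeneralLinearGroup.scalar (Fin 3)))) [μ'.IsHaarMeasure]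
  {E : Type*} [NormedAddCommGroup E] [NormedSpace ℝ E] [CompleteSpace E]

/-! ## §1  The level: `∫_{GL₃(𝒪)} F'(mk(x k)) dμ = 0 ⇒ ∫_{K_Λ} F'(mk x · k') dμ' = 0` -/

omit [CompleteSpace E] in
include hϖ in
/-- **LEVEL DESCENT.**  `GL₃(𝒪) ∩ ϖ^ℤ·1 = 1`, so the quotient map restricts to an isomorphism `GL₃(𝒪) ≅ K_Λ = mk(GL₃(𝒪))` carrying `μ|_{GL₃(𝒪)}` to `c·μ'|_{K_Λ}`, `c > 0` (★ B0b
`exists_map_restrict_smul_eq`); hence `∫_{GL₃(𝒪)} F'(mk(x k)) dμ(k) = 0` implies `∫_{K_Λ} F'(mk x · k') dμ'(k') = 0` for continuous `F'`. [cite: WeilBNT1967, Ch. II §5]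
[cite: HarishChandra1970, Part VII §3 p. 71] -/
theorem setIntegral_kLambda_eq_zero_of_setIntegral_glInt_eq_zero
    (F' : GL (Fin 3) F ⧸ (Subgroup.zpowers (Units.mk0 ϖ hϖ0)).map (Matrix.GeneralLinearGroup.scalar (Fin 3)) → E) (hF' : Continuous F') (x : GL (Fin 3) F)
    (h : ∫ k in (glInt 3 F : Set (GL (Fin 3) F)),
      F' (QuotientGroup.mk (x * k) : GL (Fin 3) F ⧸ (Subgroup.zpowers (Units.mk0 ϖ hϖ0)).map (Matrix.GeneralLinearGroup.scalar (Fin 3))) ∂μ = 0) :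
    ∫ k' in (((glInt 3 F).map (QuotientGroup.mk' ((Subgroup.zpowers (Units.mk0 ϖ hϖ0)).map (Matrix.GeneralLinearGroup.scalar (Fin 3))))) :
        Set (GL (Fin 3) F ⧸ (Subgroup.zpowers (Units.mk0 ϖ hϖ0)).map (Matrix.GeneralLinearGroup.scalar (Fin 3)))),
      F' ((QuotientGroup.mk x : GL (Fin 3) F ⧸ (Subgroup.zpowers (Units.mk0 ϖ hϖ0)).map (Matrix.GeneralLinearGroup.scalar (Fin 3))) * k') ∂μ' = 0 := by
  haveI : SecondCountableTopology (GL (Fin 3) F) := secondCountableTopology_gl3 F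
  haveI : LocallyCompactSpace (GL (Fin 3) F) := locallyCompactSpace_gl3 F
  obtain ⟨c, hc, hmap⟩ := K2E3CoveringHomLocalHaar.exists_map_restrict_smul_eq (QuotientGroup.mk' ((Subgroup.zpowers (Units.mk0 ϖ hϖ0)).map (Matrix.GeneralLinearGroup.scalar (Fin 3)))) QuotientGroup.continuous_mk
    QuotientGroup.isOpenMap_coe (glInt 3 F) (isOpen_glInt 3 F) (fun k hk h1 => eq_one_of_mem_glInt_of_mk_eq_one hϖ hϖ0 hk h1) μ μ'
  have key := K2E3CoveringHomLocalHaar.setIntegral_comp_eq_of_map_restrict_eq (p := QuotientGroup.mk' ((Subgroup.zpowers (Units.mk0 ϖ hϖ0)).map (Matrix.GeneralLinearGroup.scalar (Fin 3)))) (g := (1 : GL (Fin 3) F))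
    QuotientGroup.continuous_mk.measurable (hmap 1)
    (fun k' => F' ((QuotientGroup.mk x : GL (Fin 3) F ⧸ ((Subgroup.zpowers (Units.mk0 ϖ hϖ0)).map (Matrix.GeneralLinearGroup.scalar (Fin 3)))) * k')) ((hF'.comp (continuous_const.mul continuous_id)).aestronglyMeasurable)
  rw [one_smul, map_one, one_smul, QuotientGroup.coe_mk'] at key
  have hfun : (fun k : GL (Fin 3) F => F' ((QuotientGroup.mk x : GL (Fin 3) F ⧸ ((Subgroup.zpowers (Units.mk0 ϖ hϖ0)).map (Matrix.GeneralLinearGroup.scalar (Fin 3)))) * (QuotientGroup.mk k : GL (Fin 3) F ⧸ ((Subgroup.zpowers (Units.mk0 ϖ hϖ0)).map (Matrix.GeneralLinearGroup.scalar (Fin 3)))))) =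
      fun k : GL (Fin 3) F => F' (QuotientGroup.mk (x * k) : GL (Fin 3) F ⧸ ((Subgroup.zpowers (Units.mk0 ϖ hϖ0)).map (Matrix.GeneralLinearGroup.scalar (Fin 3)))) := by
    funext k
    rw [← QuotientGroup.mk_mul]
  rw [hfun, h] at key
  rw [Subgroup.coe_map, QuotientGroup.coe_mk']
  rcases smul_eq_zero.1 key.symm with h0 | h0
  · exact absurd h0 hc.ne'
  · exact h0

/-! ## §2  The shells of `G'` -/

include hϖ in
/-- **SHELL VANISHING FROM THE UPSTAIRS LEVEL STATEMENTS.**  Let `Ω` be a compact exhaustion of `G'` whose balls have p14's membership (`hmem`) and are bi-invariant under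
`K_Λ` (`hK`), `μ, μ'` Haar measures, `F'` continuous.  If `∫_{GL₃(𝒪)} F'(mk(x k)) dμ(k) = 0` for every `x` with `¬ 𝔅_R(x)`, then `∫_{Ω n ∖ Ω R} F' dμ' = 0` for every `n`
(§1 at each point of the right-`K_Λ`-invariant shell + ★ `setIntegral_eq_zero_of_forall_setIntegral_mul_eq_zero`). [cite: HarishChandra1970, Part VII §3 p. 71 eq. (1)]
[cite: Folland1995, §2.6] -/
theorem setIntegral_sdiff_eq_zero_of_forall_upstairs
    (Ω : CompactExhaustion (GL (Fin 3) F ⧸ (Subgroup.zpowers (Units.mk0 ϖ hϖ0)).map (Matrix.GeneralLinearGroup.scalar (Fin 3))))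
    (hmem : ∀ (m : ℕ) (g : GL (Fin 3) F),
      (QuotientGroup.mk g : GL (Fin 3) F ⧸ (Subgroup.zpowers (Units.mk0 ϖ hϖ0)).map (Matrix.GeneralLinearGroup.scalar (Fin 3))) ∈ Ω m ↔
        ∀ i j k l, Valued.v (ϖ ^ m * ((g : Matrix (Fin 3) (Fin 3) F) i j * ((g⁻¹ : GL (Fin 3) F) : Matrix (Fin 3) (Fin 3) F) k l)) ≤ 1)
    (hK : ∀ (m : ℕ) (k : GL (Fin 3) F), k ∈ glInt 3 F → ∀ x : GL (Fin 3) F ⧸ (Subgroup.zpowers (Units.mk0 ϖ hϖ0)).map (Matrix.GeneralLinearGroup.scalar (Fin 3)),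
      ((QuotientGroup.mk k : GL (Fin 3) F ⧸ _) * x ∈ Ω m ↔ x ∈ Ω m) ∧ (x * (QuotientGroup.mk k : GL (Fin 3) F ⧸ _) ∈ Ω m ↔ x ∈ Ω m))
    (F' : GL (Fin 3) F ⧸ (Subgroup.zpowers (Units.mk0 ϖ hϖ0)).map (Matrix.GeneralLinearGroup.scalar (Fin 3)) → E) (hF' : Continuous F') {R : ℕ}
    (h : ∀ x : GL (Fin 3) F, ¬ (∀ i j k l, Valued.v (ϖ ^ R * ((x : Matrix (Fin 3) (Fin 3) F) i j * ((x⁻¹ : GL (Fin 3) F) : Matrix (Fin 3) (Fin 3) F) k l)) ≤ 1) →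
      ∫ k in (glInt 3 F : Set (GL (Fin 3) F)),
        F' (QuotientGroup.mk (x * k) : GL (Fin 3) F ⧸ (Subgroup.zpowers (Units.mk0 ϖ hϖ0)).map (Matrix.GeneralLinearGroup.scalar (Fin 3))) ∂μ = 0)
    (n : ℕ) : ∫ x in Ω n \ Ω R, F' x ∂μ' = 0 := by
  haveI : SecondCountableTopology (GL (Fin 3) F) := secondCountableTopology_gl3 F
  haveI : LocallyCompactSpace (GL (Fin 3) F) := locallyCompactSpace_gl3 F
  have hΛ : IsClosed ((Subgroup.zpowers (Units.mk0 ϖ hϖ0) : Subgroup Fˣ) : Set Fˣ) := isClosed_zpowers_uniformizer hϖ hϖ0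
  haveI : T2Space (GL (Fin 3) F ⧸ ((Subgroup.zpowers (Units.mk0 ϖ hϖ0)).map (Matrix.GeneralLinearGroup.scalar (Fin 3)))) := t2Space_quotScalar _ hΛ
  haveI : μ'.IsMulRightInvariant := isMulRightInvariant_quotScalar_of_isHaarMeasure _ hΛ hϖ μ'
  -- the compact open level `K_Λ`
  have hKc : IsCompact (((glInt 3 F).map (QuotientGroup.mk' ((Subgroup.zpowers (Units.mk0 ϖ hϖ0)).map (Matrix.GeneralLinearGroup.scalar (Fin 3)))) : Subgroup (GL (Fin 3) F ⧸ ((Subgroup.zpowers (Units.mk0 ϖ hϖ0)).map (Matrix.GeneralLinearGroup.scalar (Fin 3))))) : Set (GL (Fin 3) F ⧸ ((Subgroup.zpowers (Units.mk0 ϖ hϖ0)).map (Matrix.GeneralLinearGroup.scalar (Fin 3))))) := isCompact_kLambda _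
  have hKo : IsOpen (((glInt 3 F).map (QuotientGroup.mk' ((Subgroup.zpowers (Units.mk0 ϖ hϖ0)).map (Matrix.GeneralLinearGroup.scalar (Fin 3)))) : Subgroup (GL (Fin 3) F ⧸ ((Subgroup.zpowers (Units.mk0 ϖ hϖ0)).map (Matrix.GeneralLinearGroup.scalar (Fin 3))))) : Set (GL (Fin 3) F ⧸ ((Subgroup.zpowers (Units.mk0 ϖ hϖ0)).map (Matrix.GeneralLinearGroup.scalar (Fin 3))))) := isOpen_kLambda _
  have hKpos : μ' (((glInt 3 F).map (QuotientGroup.mk' ((Subgroup.zpowers (Units.mk0 ϖ hϖ0)).map (Matrix.GeneralLinearGroup.scalar (Fin 3)))) : Subgroup (GL (Fin 3) F ⧸ ((Subgroup.zpowers (Units.mk0 ϖ hϖ0)).map (Matrix.GeneralLinearGroup.scalar (Fin 3))))) : Set (GL (Fin 3) F ⧸ ((Subgroup.zpowers (Units.mk0 ϖ hϖ0)).map (Matrix.GeneralLinearGroup.scalar (Fin 3))))) ≠ 0 :=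
    hKo.measure_ne_zero μ' ⟨1, Subgroup.one_mem _⟩
  -- the shell: measurable, relatively compact, right-`K_Λ`-invariant
  have hSm : MeasurableSet (Ω n \ Ω R) := (Ω.isCompact n).measurableSet.diff (Ω.isCompact R).measurableSet
  have hSc : IsCompact (closure (Ω n \ Ω R)) := (Ω.isCompact n).closure_of_subset sdiff_subset
  have hSK : ∀ x ∈ Ω n \ Ω R, ∀ k ∈ ((glInt 3 F).map (QuotientGroup.mk' ((Subgroup.zpowers (Units.mk0 ϖ hϖ0)).map (Matrix.GeneralLinearGroup.scalar (Fin 3)))) : Subgroup (GL (Fin 3) F ⧸ ((Subgroup.zpowers (Units.mk0 ϖ hϖ0)).map (Matrix.GeneralLinearGroup.scalar (Fin 3))))), x * k ∈ Ω n \ Ω R := by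
    intro x hx k hk
    obtain ⟨k₀, hk₀, rfl⟩ := Subgroup.mem_map.1 hk
    exact ⟨((hK n k₀ hk₀ x).2).2 hx.1, fun h' => hx.2 (((hK R k₀ hk₀ x).2).1 h')⟩
  -- §1 at every point of the shell
  have h0 : ∀ x ∈ Ω n \ Ω R, ∫ k in (((glInt 3 F).map (QuotientGroup.mk' ((Subgroup.zpowers (Units.mk0 ϖ hϖ0)).map (Matrix.GeneralLinearGroup.scalar (Fin 3)))) : Subgroup (GL (Fin 3) F ⧸ ((Subgroup.zpowers (Units.mk0 ϖ hϖ0)).map (Matrix.GeneralLinearGroup.scalar (Fin 3))))) : Set (GL (Fin 3) F ⧸ ((Subgroup.zpowers (Units.mk0 ϖ hϖ0)).map (Matrix.GeneralLinearGroup.scalar (Fin 3))))),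
      F' (x * k) ∂μ' = 0 := by
    intro x hx
    obtain ⟨x₀, rfl⟩ := QuotientGroup.mk_surjective x
    have hx₀ : ¬ (∀ i j k l, Valued.v (ϖ ^ R * ((x₀ : Matrix (Fin 3) (Fin 3) F) i j * ((x₀⁻¹ : GL (Fin 3) F) : Matrix (Fin 3) (Fin 3) F) k l)) ≤ 1) :=
      fun hb => hx.2 ((hmem R x₀).2 hb)
    exact setIntegral_kLambda_eq_zero_of_setIntegral_glInt_eq_zero hϖ hϖ0 μ μ' F' hF' x₀ (h x₀ hx₀)
  exact K2E3RightInvariantSetIntegralVanishing.setIntegral_eq_zero_of_forall_setIntegral_mul_eq_zero μ' _ hKc hKpos hSm hSc hSK F' hF' h0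

include hϖ in
/-- **THE `hcanc` SHAPE**: under the hypotheses of `setIntegral_sdiff_eq_zero_of_forall_upstairs`, `∫_{Ω n} F' dμ' = ∫_{Ω n ∩ Ω R} F' dμ'` for every `n`.
[cite: HarishChandra1970, Part VII §3 p. 72] -/
theorem setIntegral_eq_setIntegral_inter_of_forall_upstairs
    (Ω : CompactExhaustion (GL (Fin 3) F ⧸ (Subgroup.zpowers (Units.mk0 ϖ hϖ0)).map (Matrix.GeneralLinearGroup.scalar (Fin 3))))
    (hmem : ∀ (m : ℕ) (g : GL (Fin 3) F),
      (QuotientGroup.mk g : GL (Fin 3) F ⧸ (Subgroup.zpowers (Units.mk0 ϖ hϖ0)).map (Matrix.GeneralLinearGroup.scalar (Fin 3))) ∈ Ω m ↔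
        ∀ i j k l, Valued.v (ϖ ^ m * ((g : Matrix (Fin 3) (Fin 3) F) i j * ((g⁻¹ : GL (Fin 3) F) : Matrix (Fin 3) (Fin 3) F) k l)) ≤ 1)
    (hK : ∀ (m : ℕ) (k : GL (Fin 3) F), k ∈ glInt 3 F → ∀ x : GL (Fin 3) F ⧸ (Subgroup.zpowers (Units.mk0 ϖ hϖ0)).map (Matrix.GeneralLinearGroup.scalar (Fin 3)),
      ((QuotientGroup.mk k : GL (Fin 3) F ⧸ _) * x ∈ Ω m ↔ x ∈ Ω m) ∧ (x * (QuotientGroup.mk k : GL (Fin 3) F ⧸ _) ∈ Ω m ↔ x ∈ Ω m))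
    (F' : GL (Fin 3) F ⧸ (Subgroup.zpowers (Units.mk0 ϖ hϖ0)).map (Matrix.GeneralLinearGroup.scalar (Fin 3)) → E) (hF' : Continuous F') {R : ℕ}
    (h : ∀ x : GL (Fin 3) F, ¬ (∀ i j k l, Valued.v (ϖ ^ R * ((x : Matrix (Fin 3) (Fin 3) F) i j * ((x⁻¹ : GL (Fin 3) F) : Matrix (Fin 3) (Fin 3) F) k l)) ≤ 1) →
      ∫ k in (glInt 3 F : Set (GL (Fin 3) F)),
        F' (QuotientGroup.mk (x * k) : GL (Fin 3) F ⧸ (Subgroup.zpowers (Units.mk0 ϖ hϖ0)).map (Matrix.GeneralLinearGroup.scalar (Fin 3))) ∂μ = 0)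
    (n : ℕ) : ∫ x in Ω n, F' x ∂μ' = ∫ x in Ω n ∩ Ω R, F' x ∂μ' := by
  haveI : SecondCountableTopology (GL (Fin 3) F) := secondCountableTopology_gl3 F
  haveI : LocallyCompactSpace (GL (Fin 3) F) := locallyCompactSpace_gl3 F
  haveI : T2Space (GL (Fin 3) F ⧸ (Subgroup.zpowers (Units.mk0 ϖ hϖ0)).map (Matrix.GeneralLinearGroup.scalar (Fin 3))) :=
    t2Space_quotScalar _ (isClosed_zpowers_uniformizer hϖ hϖ0)
  have hint : IntegrableOn F' (Ω n) μ' := hF'.continuousOn.integrableOn_compact (Ω.isCompact n)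
  rw [← integral_inter_add_sdiff (Ω.isCompact R).measurableSet hint,
    setIntegral_sdiff_eq_zero_of_forall_upstairs hϖ hϖ0 μ μ' Ω hmem hK F' hF' h n, add_zero]

/-! ## §3  The reading for (C): conjugation slices -/

include hϖ in
/-- **`hcanc` AT `ḡ = mk (y γ y⁻¹)` FROM THE UPSTAIRS CANCELLATION OF THE SLICE `f z = θ(mk(z γ z⁻¹))`.**  With (C)'s conclusion `∫_{GL₃(𝒪)} f (x k y) dμ(k) = 0` for
all `x` with `¬ 𝔅_R(x)` (K2E5-p17's `cuspForm_cancellation_GL3_split`, `f (x k y) = θ(mk((x k y) γ (x k y)⁻¹))`), for every `n`: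
`∫_{Ω n} θ(x̄ ḡ x̄⁻¹) dμ'(x̄) = ∫_{Ω n ∩ Ω R} θ(x̄ ḡ x̄⁻¹) dμ'(x̄)` — the `hcanc` conjunct of ★ ASM-core `nonEllEstimates_of_radius` at `ḡ`.
[cite: HarishChandra1970, Part VII §2 Thm 20 p. 70, §3 pp. 71–72] -/
theorem setIntegral_conj_eq_setIntegral_inter_of_cuspForm_cancellation
    (Ω : CompactExhaustion (GL (Fin 3) F ⧸ (Subgroup.zpowers (Units.mk0 ϖ hϖ0)).map (Matrix.GeneralLinearGroup.scalar (Fin 3))))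
    (hmem : ∀ (m : ℕ) (g : GL (Fin 3) F),
      (QuotientGroup.mk g : GL (Fin 3) F ⧸ (Subgroup.zpowers (Units.mk0 ϖ hϖ0)).map (Matrix.GeneralLinearGroup.scalar (Fin 3))) ∈ Ω m ↔
        ∀ i j k l, Valued.v (ϖ ^ m * ((g : Matrix (Fin 3) (Fin 3) F) i j * ((g⁻¹ : GL (Fin 3) F) : Matrix (Fin 3) (Fin 3) F) k l)) ≤ 1)
    (hK : ∀ (m : ℕ) (k : GL (Fin 3) F), k ∈ glInt 3 F → ∀ x : GL (Fin 3) F ⧸ (Subgroup.zpowers (Units.mk0 ϖ hϖ0)).map (Matrix.GeneralLinearGroup.scalar (Fin 3)),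
      ((QuotientGroup.mk k : GL (Fin 3) F ⧸ _) * x ∈ Ω m ↔ x ∈ Ω m) ∧ (x * (QuotientGroup.mk k : GL (Fin 3) F ⧸ _) ∈ Ω m ↔ x ∈ Ω m))
    (θ : GL (Fin 3) F ⧸ (Subgroup.zpowers (Units.mk0 ϖ hϖ0)).map (Matrix.GeneralLinearGroup.scalar (Fin 3)) → E) (hθ : Continuous θ)
    (γ y : GL (Fin 3) F) {R : ℕ}
    (h20 : ∀ x : GL (Fin 3) F, ¬ (∀ i j k l, Valued.v (ϖ ^ R * ((x : Matrix (Fin 3) (Fin 3) F) i j * ((x⁻¹ : GL (Fin 3) F) : Matrix (Fin 3) (Fin 3) F) k l)) ≤ 1) →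
      ∫ k in (glInt 3 F : Set (GL (Fin 3) F)),
        θ (QuotientGroup.mk ((x * k * y) * γ * (x * k * y)⁻¹) : GL (Fin 3) F ⧸ (Subgroup.zpowers (Units.mk0 ϖ hϖ0)).map (Matrix.GeneralLinearGroup.scalar (Fin 3))) ∂μ = 0)
    (n : ℕ) :
    ∫ x in Ω n, θ (x * QuotientGroup.mk (y * γ * y⁻¹) * x⁻¹) ∂μ' = ∫ x in Ω n ∩ Ω R, θ (x * QuotientGroup.mk (y * γ * y⁻¹) * x⁻¹) ∂μ' := by
  have hF' : Continuous fun x : GL (Fin 3) F ⧸ (Subgroup.zpowers (Units.mk0 ϖ hϖ0)).map (Matrix.GeneralLinearGroup.scalar (Fin 3)) =>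
      θ (x * QuotientGroup.mk (y * γ * y⁻¹) * x⁻¹) :=
    hθ.comp ((continuous_id.mul continuous_const).mul continuous_id.inv)
  refine setIntegral_eq_setIntegral_inter_of_forall_upstairs hϖ hϖ0 μ μ' Ω hmem hK _ hF' (fun x hx => ?_) n
  have heq : (fun k : GL (Fin 3) F => θ ((QuotientGroup.mk (x * k) : GL (Fin 3) F ⧸ (Subgroup.zpowers (Units.mk0 ϖ hϖ0)).map (Matrix.GeneralLinearGroup.scalar (Fin 3))) *
      QuotientGroup.mk (y * γ * y⁻¹) * (QuotientGroup.mk (x * k))⁻¹)) =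
      fun k : GL (Fin 3) F => θ (QuotientGroup.mk ((x * k * y) * γ * (x * k * y)⁻¹)) := by
    funext k
    rw [← QuotientGroup.mk_inv, ← QuotientGroup.mk_mul, ← QuotientGroup.mk_mul]
    congr 2
    group
  rw [heq]
  exact h20 x hx

end Summit.HodgeConjecture.HodgeConjecture.Cruxes.H413.K2E3GL3CuspFormCancellationShell

end
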